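import Literature.Computability.QuantumComplexity.GluedTreesThm9Graph
import Mathlib.Algebra.BigOperators.Fin
import HarnessLib

/-!
# Glued trees, Theorem 9 (classical lower bound) — the view of the algorithm (names, view states, replay)

This module concatenates 3 parts of the proof of `ChildsEtAl2003_thm9`, each with its own
module docstring below: part `Names`, part `View`, part `Replay`.
-/
/-!
# Glued trees, Theorem 9 (classical lower bound) — II: names, encodings, the oracle as printed

Theorem-only support file for `ChildsEtAl2003_thm9`. It identifies the string oracle
`GluedTrees.strOracle σ ν` of `GluedTrees.lean` with the name-level description used in the
proof: on a `2n`-bit query naming the vertex `v` it returns `encL (canon S)` where `S` is the set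
of names of the neighbours of `v`, and `[]` on every other query ("if there exists a vertex with
that name, the oracle returns the names of the neighbors of that vertex", Game 1, p. 11).

* `nameOfVal_nameVal`: reading the bits of the binary value gives the name back, so the
  canonical listing `canon S` lists exactly `S`, without repetition (`mem_canon`, `canon_nodup`,
  `canon_toFinset`, `length_canon`);
* `encL_injective`, `decL_encL`: the concatenation of `2n`-bit names is uniquely decodable
  (`1 ≤ n`);
* `vtx_apply`, `apply_vtx`: `vtx ν` inverts the naming on named vertices;
* `nbrNames_apply`, `nbrNames_eq_empty`, `strOracle_eq_encL`, `strOracle_of_length_ne`,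
  `strOracle_apply_name`, `strOracle_of_not_isName`: the oracle unfolded.

## References

* [ChildsEtAl2003] A. M. Childs et al., Exponential algorithmic speedup by a quantum walk,
  STOC 2003, §2 and §4 (Game 1).
-/

namespace Literature.Computability.QuantumComplexity

namespace GluedTrees

open Finset

variable {n : ℕ}

/-! ### Binary values of names -/

/-- Reading off the bits of the binary value of a name gives the name back.
[cite: ChildsEtAl2003, §2] -/
theorem nameOfVal_nameVal {N : ℕ} (a : Fin N → Bool) : nameOfVal N (nameVal a) = a := by
  funext j
  let g : Fin N → Fin 2 := fun i ↦ ⟨(a i).toNat, by cases a i <;> simp⟩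
  have hval : nameVal a = (finFunctionFinEquiv g : ℕ) := by
    rw [finFunctionFinEquiv_apply]; rfl
  have hdiv : nameVal a / 2 ^ (j : ℕ) % 2 = (a j).toNat := by
    have h := congrArg (fun f : Fin N → Fin 2 ↦ (f j : ℕ)) (finFunctionFinEquiv.symm_apply_apply g)
    simp only [finFunctionFinEquiv_symm_apply_val] at h
    rw [hval]
    exact h
  show (nameVal a).testBit j = a j
  rw [Nat.testBit_eq_decide_div_mod_eq, hdiv]
  cases a j <;> simp

/-- The binary value is injective on names of a fixed length. [cite: ChildsEtAl2003, §2] -/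
theorem nameVal_injective {N : ℕ} : Function.Injective (nameVal (N := N)) := by
  intro a b h
  rw [← nameOfVal_nameVal a, h, nameOfVal_nameVal]

/-! ### The canonical listing -/

/-- `canon S` lists exactly the elements of `S`. [cite: ChildsEtAl2003, §4 (Game 1)] -/
theorem mem_canon {S : Finset (Name n)} {a : Name n} : a ∈ canon S ↔ a ∈ S := by
  simp only [canon, List.mem_map, Finset.mem_sort, Finset.mem_image]
  constructor
  · rintro ⟨m, ⟨b, hb, rfl⟩, rfl⟩
    rwa [nameOfVal_nameVal]
  · intro ha
    exact ⟨nameVal a, ⟨a, ha, rfl⟩, nameOfVal_nameVal a⟩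

/-- `canon S` has no repetition. [cite: ChildsEtAl2003, §4 (Game 1)] -/
theorem canon_nodup (S : Finset (Name n)) : (canon S).Nodup := by
  unfold canon
  refine List.Nodup.map_on ?_ (Finset.sort_nodup _ _)
  intro x hx y hy hxy
  rw [Finset.mem_sort, Finset.mem_image] at hx hy
  obtain ⟨a, -, rfl⟩ := hx
  obtain ⟨b, -, rfl⟩ := hy
  rw [nameOfVal_nameVal, nameOfVal_nameVal] at hxy
  rw [hxy]

/-- `canon S` as a finset is `S`. [cite: ChildsEtAl2003, §4 (Game 1)] -/
theorem canon_toFinset (S : Finset (Name n)) : (canon S).toFinset = S := by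
  ext a; rw [List.mem_toFinset, mem_canon]

/-- `canon S` has `|S|` entries. [cite: ChildsEtAl2003, §4 (Game 1)] -/
theorem length_canon (S : Finset (Name n)) : (canon S).length = S.card := by
  rw [← canon_toFinset S, List.toFinset_card_of_nodup (canon_nodup S), canon_toFinset]

/-- `canon` is injective. [cite: ChildsEtAl2003, §4 (Game 1)] -/
theorem canon_injective : Function.Injective (canon (n := n)) := by
  intro S T h
  rw [← canon_toFinset S, h, canon_toFinset]

/-- The two entries of the canonical listing of a two-element set. [folklore] -/
theorem canon_pair_getD {F : Finset (Name n)} (hF : F.card = 2) (d : Name n) :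
    (canon F).getD 0 d ∈ F ∧ (canon F).getD 1 d ∈ F ∧ (canon F).getD 0 d ≠ (canon F).getD 1 d ∧
      F = {(canon F).getD 0 d, (canon F).getD 1 d} := by
  have hl : (canon F).length = 2 := by rw [length_canon, hF]
  have hnd := canon_nodup F
  obtain ⟨a, b, hab⟩ : ∃ a b, canon F = [a, b] := by
    match h : canon F, hl with
    | [a, b], _ => exact ⟨a, b, rfl⟩
  have hFab : F = {a, b} := by rw [← canon_toFinset F, hab]; simp
  rw [hab] at hnd
  have hne : a ≠ b := by simpa using hnd
  rw [hab]
  simp only [List.getD_cons_zero, List.getD_cons_succ]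
  refine ⟨by simp [hFab], by simp [hFab], hne, hFab⟩

/-! ### Encoding and decoding lists of names -/

/-- Encoding a cons. [folklore] -/
theorem encL_cons (a : Name n) (L : List (Name n)) : encL (a :: L) = List.ofFn a ++ encL L := by
  simp [encL]

/-- Encoding the empty list. [folklore] -/
@[simp] theorem encL_nil : encL ([] : List (Name n)) = [] := by simp [encL]

/-- The length of an encoding. [folklore] -/
theorem length_encL (L : List (Name n)) : (encL L).length = 2 * n * L.length := by
  induction L with
  | nil => simp
  | cons a L ih => rw [encL_cons, List.length_append, List.length_ofFn, ih]; simp; ring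

/-- The concatenation of `2n`-bit names is uniquely decodable (`1 ≤ n`). [cite: ChildsEtAl2003, §4 (Game 1)] -/
theorem encL_injective (hn : 1 ≤ n) : Function.Injective (encL (n := n)) := by
  intro L
  induction L with
  | nil =>
    intro L' h
    cases L' with
    | nil => rfl
    | cons b L' =>
      have := congrArg List.length h
      rw [encL_nil, length_encL] at this
      simp at this
      omega
  | cons a L ih =>
    intro L' h
    cases L' with
    | nil =>
      have := congrArg List.length h
      rw [encL_nil, length_encL] at this
      simp at this
      omega
    | cons b L' =>
      rw [encL_cons, encL_cons] at h
      obtain ⟨h1, h2⟩ := List.append_inj h (by simp)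
      rw [List.ofFn_inj.mp h1, ih h2]

/-- Decoding an encoding (`1 ≤ n`). [cite: ChildsEtAl2003, §4 (Game 1)] -/
theorem decL_encL (hn : 1 ≤ n) (L : List (Name n)) : decL n (encL L) = some L := by
  unfold decL
  have h : ∃ L' : List (Name n), encL L' = encL L := ⟨L, rfl⟩
  rw [dif_pos h, Option.some.injEq]
  exact encL_injective hn h.choose_spec

/-- A string that decodes is the encoding of its decoding. [cite: ChildsEtAl2003, §4 (Game 1)] -/
theorem encL_of_decL_eq_some {a : List Bool} {L : List (Name n)} (h : decL n a = some L) : encL L = a := by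
  unfold decL at h
  split_ifs at h with h'
  rw [Option.some.injEq] at h
  rw [← h]
  exact h'.choose_spec

/-- The encoding of a one-name list is the name's bit string. [folklore] -/
theorem encL_singleton (a : Name n) : encL [a] = List.ofFn a := by simp [encL]

/-- Reading the name off its own bit string. [folklore] -/
theorem nameOfStr_ofFn (a : Name n) : nameOfStr n (List.ofFn a) = a := by
  unfold nameOfStr
  rw [dif_pos (List.length_ofFn)]
  funext i
  simp [List.get_eq_getElem]

/-- A bit string of length `2n` is the bit string of the name read off it. [folklore] -/
theorem ofFn_nameOfStr {q : List Bool} (hq : q.length = 2 * n) : List.ofFn (nameOfStr n q) = q := by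
  unfold nameOfStr
  rw [dif_pos hq]
  apply List.ext_getElem (by simp [hq])
  intro i h1 h2
  simp [List.get_eq_getElem]

/-! ### The vertex of a name -/

/-- `vtx ν` inverts `ν` on vertices. [folklore] -/
@[simp] theorem vtx_apply (ν : Vertex n ↪ Name n) (v : Vertex n) : vtx ν (ν v) = v := by
  unfold vtx
  have h : ∃ w, ν w = ν v := ⟨v, rfl⟩
  rw [dif_pos h]
  exact ν.injective h.choose_spec

/-- `ν` inverts `vtx ν` on names of vertices. [folklore] -/
theorem apply_vtx (ν : Vertex n ↪ Name n) {a : Name n} (h : ∃ v, ν v = a) : ν (vtx ν a) = a := by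
  obtain ⟨v, rfl⟩ := h
  rw [vtx_apply]

/-! ### The oracle, unfolded -/

/-- The neighbour-name set at the name of a vertex: the names of its neighbours.
[cite: ChildsEtAl2003, §4 (Game 1)] -/
theorem nbrNames_apply (σ : CycleDatum n) (ν : Vertex n ↪ Name n) (v : Vertex n) :
    nbrNames σ ν (ν v) = ((graph n σ).neighborFinset v).map ν := by
  unfold nbrNames
  have : (Finset.univ.filter fun w ↦ ν w = ν v) = {v} := by
    ext w; simp [ν.injective.eq_iff]
  rw [this, Finset.singleton_biUnion]

/-- The neighbour-name set at a string naming no vertex is empty. [cite: ChildsEtAl2003, §4 (Game 1)] -/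
theorem nbrNames_eq_empty (σ : CycleDatum n) (ν : Vertex n ↪ Name n) {a : Name n} (h : ¬ ∃ v, ν v = a) :
    nbrNames σ ν a = ∅ := by
  unfold nbrNames
  have : (Finset.univ.filter fun w ↦ ν w = a) = ∅ := by
    ext w
    simp only [Finset.mem_filter, Finset.mem_univ, true_and, Finset.notMem_empty, iff_false]
    exact fun hw ↦ h ⟨w, hw⟩
  rw [this, Finset.biUnion_empty]

/-- The string oracle on a `2n`-bit query, at the name level. [cite: ChildsEtAl2003, §4 (Game 1)] -/
theorem strOracle_eq_encL (σ : CycleDatum n) (ν : Vertex n ↪ Name n) {q : List Bool} (hq : q.length = 2 * n) :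
    strOracle σ ν q = encL (canon (nbrNames σ ν (nameOfStr n q))) := by
  unfold strOracle nameOfStr
  rw [dif_pos hq, dif_pos hq]
  rfl

/-- The string oracle answers `[]` to queries of the wrong length. [cite: ChildsEtAl2003, §4 (Game 1)] -/
theorem strOracle_of_length_ne (σ : CycleDatum n) (ν : Vertex n ↪ Name n) {q : List Bool} (hq : q.length ≠ 2 * n) :
    strOracle σ ν q = [] := by
  unfold strOracle
  rw [dif_neg hq]

/-- The string oracle on the name of a vertex: the canonical listing of the names of its
neighbours, concatenated. [cite: ChildsEtAl2003, §4 (Game 1)] -/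
theorem strOracle_apply_name (σ : CycleDatum n) (ν : Vertex n ↪ Name n) (v : Vertex n) :
    strOracle σ ν (List.ofFn (ν v)) = encL (canon (((graph n σ).neighborFinset v).map ν)) := by
  rw [strOracle_eq_encL σ ν (List.length_ofFn), nameOfStr_ofFn, nbrNames_apply]

/-- The string oracle on a `2n`-bit string naming no vertex: INVALID. [cite: ChildsEtAl2003, §4 (Game 1)] -/
theorem strOracle_of_not_isName (σ : CycleDatum n) (ν : Vertex n ↪ Name n) {q : List Bool} (hq : q.length = 2 * n)
    (h : ¬ ∃ v, ν v = nameOfStr n q) : strOracle σ ν q = [] := by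
  rw [strOracle_eq_encL σ ν hq, nbrNames_eq_empty σ ν h]
  simp [canon, encL]

/-- The answer at the name of a vertex is never INVALID (`1 ≤ n`). [cite: ChildsEtAl2003, §4 (Game 1)] -/
theorem strOracle_apply_name_ne_nil (hn : 1 ≤ n) (σ : CycleDatum n) (ν : Vertex n ↪ Name n) (v : Vertex n) :
    strOracle σ ν (List.ofFn (ν v)) ≠ [] := by
  rw [strOracle_apply_name]
  intro h
  have h1 := congrArg List.length h
  rw [length_encL, length_canon, Finset.card_map, SimpleGraph.card_neighborFinset_eq_degree,
    degree_eq hn] at h1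
  split_ifs at h1 <;> simp at h1 <;> omega

end GluedTrees

end Literature.Computability.QuantumComplexity

/-!
# Glued trees, Theorem 9 (classical lower bound) — III: calculus of views

Theorem-only support file for `ChildsEtAl2003_thm9`: the elementary bookkeeping of §4 of
`GluedTreesThm9Defs` (views = answer lists, `viewState`, `stepState`, `Cons`) and of the
embedding `pos` (§5), with no reference yet to an actual oracle.

* `replayFrom_append_singleton`, `viewState_append_singleton`: replaying `as ++ [a]` is
  replaying `as` and then one `stepState`;
* `cons_append_singleton_iff`, `cons_nil`: consistency of an oracle with `as ++ [a]`;
* `queriesAux_succ_eq`: one round of the query transcript;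
* `nodeOf?_eq_some`, `nodeOf?_eq_none`: the node of a known name;
* `stepState_cases`: inversion of one round of bookkeeping into its four kinds (wrong length /
  repeated query / expansion / invalid);
* `posAux_stable`, `posAux_zero_eq`, `pos_le`: positions of already created nodes never change,
  the root stays at the ENTRANCE;
* `viewState_wf`: every good view has a valid expansion list, injective labels on its nodes,
  labels disjoint from the INVALID set, `E + |inv| ≤ |as|`.

## References

* [ChildsEtAl2003] A. M. Childs et al., Exponential algorithmic speedup by a quantum walk,
  STOC 2003, §4 (Games 1–5).
-/

open Literature.Computability.Complexity

namespace Literature.Computability.QuantumComplexity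

namespace GluedTrees

open Finset

variable {n : ℕ} {β : Type}

/-! ### Replaying one more answer -/

/-- Replaying `as ++ [a]` = replaying `as`, then one round. [cite: ChildsEtAl2003, §4 (Game 2)] -/
theorem replayFrom_append_singleton (M : OracleAlg β) (x : List Bool) (as : List (List Bool)) (a : List Bool) :
    ∀ (s : VState n) (pre : List (List Bool)),
      replayFrom M x s pre (as ++ [a]) =
        (replayFrom M x s pre as).bind fun s' ↦
          match M.step x (pre ++ as) with
          | Sum.inr _ => none
          | Sum.inl q => s'.stepState q a := by
  induction as with
  | nil =>
    intro s pre
    simp only [List.nil_append, replayFrom, List.append_nil, Option.bind_some]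
    cases M.step x pre with
    | inr b => rfl
    | inl q =>
      simp only
      cases s.stepState q a with
      | none => rfl
      | some s' => rfl
  | cons a₀ rest ih =>
    intro s pre
    simp only [List.cons_append, replayFrom]
    cases M.step x pre with
    | inr b => rfl
    | inl q =>
      simp only
      cases s.stepState q a₀ with
      | none => rfl
      | some s' =>
        simp only
        rw [ih s' (pre ++ [a₀]), List.append_assoc, List.singleton_append]

/-- The bookkeeping of `as ++ [a]`. [cite: ChildsEtAl2003, §4 (Game 2)] -/
theorem viewState_append_singleton (M : OracleAlg β) (x : List Bool) (as : List (List Bool)) (a : List Bool) :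
    viewState (n := n) M x (as ++ [a]) =
      (viewState M x as).bind fun s' ↦
        match M.step x as with
        | Sum.inr _ => none
        | Sum.inl q => s'.stepState q a := by
  unfold viewState
  rw [replayFrom_append_singleton]
  simp

/-- The bookkeeping of the empty view. [cite: ChildsEtAl2003, §4 (Game 1)] -/
@[simp] theorem viewState_nil (M : OracleAlg β) (x : List Bool) : viewState (n := n) M x [] = some (VState.init n) := rfl

/-- If `as ++ [a]` is good then `as` is good, the machine queried, and the round is good.
[cite: ChildsEtAl2003, §4 (Game 2)] -/
theorem viewState_append_singleton_eq_some {M : OracleAlg β} {x : List Bool} {as : List (List Bool)} {a : List Bool}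
    {s' : VState n} (h : viewState M x (as ++ [a]) = some s') :
    ∃ s q, viewState M x as = some s ∧ M.step x as = Sum.inl q ∧ s.stepState q a = some s' := by
  rw [viewState_append_singleton] at h
  cases hs : viewState (n := n) M x as with
  | none => rw [hs] at h; simp at h
  | some s =>
    rw [hs, Option.bind_some] at h
    cases hq : M.step x as with
    | inr b => rw [hq] at h; simp at h
    | inl q =>
      rw [hq] at h
      exact ⟨s, q, rfl, rfl, h⟩

/-! ### Consistency with an oracle -/

/-- Every oracle is consistent with the empty view. [cite: ChildsEtAl2003, §4 (Game 1)] -/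
theorem cons_nil (M : OracleAlg β) (x : List Bool) (O : Oracle) : Cons M x O [] := by
  intro i h; simp at h

/-- Consistency with `as ++ [a]`. [cite: ChildsEtAl2003, §4 (Game 1)] -/
theorem cons_append_singleton_iff (M : OracleAlg β) (x : List Bool) (O : Oracle) (as : List (List Bool)) (a : List Bool) :
    Cons M x O (as ++ [a]) ↔ Cons M x O as ∧ ∃ q, M.step x as = Sum.inl q ∧ O q = a := by
  constructor
  · intro h
    refine ⟨?_, ?_⟩
    · intro i hi
      have hi' : i < (as ++ [a]).length := by simp; omega
      obtain ⟨q, hq, hO⟩ := h i hi'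
      refine ⟨q, ?_, ?_⟩
      · rwa [List.take_append_of_le_length hi.le] at hq
      · rw [hO, List.getElem_append_left hi]
    · have hi' : as.length < (as ++ [a]).length := by simp
      obtain ⟨q, hq, hO⟩ := h as.length hi'
      refine ⟨q, ?_, ?_⟩
      · rwa [List.take_left'] at hq; rfl
      · rw [hO]; simp
  · rintro ⟨h, q, hq, hO⟩ i hi
    simp only [List.length_append, List.length_singleton] at hi
    rcases Nat.lt_or_ge i as.length with hlt | hge
    · obtain ⟨q', hq', hO'⟩ := h i hlt
      refine ⟨q', ?_, ?_⟩
      · rwa [List.take_append_of_le_length hlt.le]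
      · rw [hO', List.getElem_append_left hlt]
    · obtain rfl : i = as.length := by omega
      refine ⟨q, ?_, ?_⟩
      · rw [List.take_left' rfl]
        exact hq
      · rw [hO]; simp

/-- One round of the query transcript. [folklore] -/
theorem queriesAux_succ_eq (M : OracleAlg β) (O : Oracle) (x : List Bool) (k : ℕ) (as : List (List Bool)) :
    M.queriesAux O x (k + 1) as =
      match M.step x as with
      | Sum.inl q => q :: M.queriesAux O x k (as ++ [O q])
      | Sum.inr _ => [] := rfl

/-! ### Nodes of known names -/

namespace VState

/-- `E` of the initial state. [folklore] -/
@[simp] theorem E_init : (VState.init n).E = 0 := rfl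

/-- `par` of the initial state. [folklore] -/
@[simp] theorem par_init : (VState.init n).par = [] := rfl

/-- `inv` of the initial state. [folklore] -/
@[simp] theorem inv_init : (VState.init n).inv = ∅ := rfl

/-- `label` of the initial state. [folklore] -/
@[simp] theorem label_init (m : ℕ) : (VState.init n).label m = fun _ ↦ false := rfl

/-- A found node carries the name and exists. [cite: ChildsEtAl2003, §4 (Game 2)] -/
theorem nodeOf?_eq_some {s : VState n} {a : Name n} {m : ℕ} (h : s.nodeOf? a = some m) :
    m ≤ 2 * s.E ∧ s.label m = a := by
  unfold nodeOf? at h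
  have h1 := List.find?_some h
  have h2 := List.mem_of_find?_eq_some h
  simp only [decide_eq_true_eq] at h1
  rw [List.mem_range] at h2
  exact ⟨by omega, h1⟩

/-- No node is found iff no existing node carries the name. [cite: ChildsEtAl2003, §4 (Game 2)] -/
theorem nodeOf?_eq_none {s : VState n} {a : Name n} :
    s.nodeOf? a = none ↔ ∀ m ≤ 2 * s.E, s.label m ≠ a := by
  unfold nodeOf?
  rw [List.find?_eq_none]
  simp only [List.mem_range, decide_eq_true_eq]
  constructor
  · intro h m hm; exact h m (by omega)
  · intro h m hm; exact h m (by omega)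

/-- With injective labels, the node found at the label of node `m` is `m`. [folklore] -/
theorem nodeOf?_label {s : VState n} (hinj : ∀ m ≤ 2 * s.E, ∀ m' ≤ 2 * s.E, s.label m = s.label m' → m = m')
    {m : ℕ} (hm : m ≤ 2 * s.E) : s.nodeOf? (s.label m) = some m := by
  cases h : s.nodeOf? (s.label m) with
  | none => exact absurd rfl (nodeOf?_eq_none.mp h m hm)
  | some m' =>
    obtain ⟨hm', hl⟩ := nodeOf?_eq_some h
    rw [hinj m' hm' m hm hl]

/-! ### The expanded state -/

/-- `E` after an expansion. [folklore] -/
@[simp] theorem E_expand (s : VState n) (m : ℕ) (F : Finset (Name n)) (d : Name n) :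
    (s.expand m F d).E = s.E + 1 := by
  simp [expand, E]

/-- `par` after an expansion. [folklore] -/
@[simp] theorem par_expand (s : VState n) (m : ℕ) (F : Finset (Name n)) (d : Name n) :
    (s.expand m F d).par = s.par ++ [m] := rfl

/-- `inv` after an expansion. [folklore] -/
@[simp] theorem inv_expand (s : VState n) (m : ℕ) (F : Finset (Name n)) (d : Name n) :
    (s.expand m F d).inv = s.inv := rfl

/-- Old labels after an expansion. [folklore] -/
theorem label_expand_of_le (s : VState n) (m : ℕ) (F : Finset (Name n)) (d : Name n) {k : ℕ} (hk : k ≤ 2 * s.E) :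
    (s.expand m F d).label k = s.label k := by
  simp [expand, Function.update_of_ne (show k ≠ 2 * s.E + 2 by omega),
    Function.update_of_ne (show k ≠ 2 * s.E + 1 by omega)]

/-- The label of the first new node. [folklore] -/
@[simp] theorem label_expand_one (s : VState n) (m : ℕ) (F : Finset (Name n)) (d : Name n) :
    (s.expand m F d).label (2 * s.E + 1) = (canon F).getD 0 d := by
  simp [expand]

/-- The label of the second new node. [folklore] -/
@[simp] theorem label_expand_two (s : VState n) (m : ℕ) (F : Finset (Name n)) (d : Name n) :
    (s.expand m F d).label (2 * s.E + 2) = (canon F).getD 1 d := by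
  simp [expand]

/-- `E` after recording an INVALID string. [folklore] -/
@[simp] theorem E_addInv (s : VState n) (a : Name n) : (s.addInv a).E = s.E := rfl

/-- `par` after recording an INVALID string. [folklore] -/
@[simp] theorem par_addInv (s : VState n) (a : Name n) : (s.addInv a).par = s.par := rfl

/-- `label` after recording an INVALID string. [folklore] -/
@[simp] theorem label_addInv (s : VState n) (a : Name n) : (s.addInv a).label = s.label := rfl

/-- `inv` after recording an INVALID string. [folklore] -/
@[simp] theorem inv_addInv (s : VState n) (a : Name n) : (s.addInv a).inv = insert a s.inv := rfl

/-- The parent lookup of an old node is unchanged by an expansion (valid lists). [folklore] -/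
theorem parentNode_expand (s : VState n) (m : ℕ) (F : Finset (Name n)) (d : Name n) {k : ℕ}
    (hk : 1 ≤ k) (hk' : k ≤ 2 * s.E) : (s.expand m F d).parentNode k = s.parentNode k := by
  unfold parentNode
  rw [par_expand, List.getD_eq_getElem?_getD, List.getD_eq_getElem?_getD,
    List.getElem?_append_left (by unfold E at hk'; omega)]

/-- The parent of a new node is the expanded node. [folklore] -/
theorem parentNode_expand_new (s : VState n) (m : ℕ) (F : Finset (Name n)) (d : Name n) {k : ℕ}
    (hk : k = 2 * s.E + 1 ∨ k = 2 * s.E + 2) : (s.expand m F d).parentNode k = m := by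
  unfold parentNode
  have : (k - 1) / 2 = s.par.length := by unfold E at hk; omega
  rw [par_expand, List.getD_eq_getElem?_getD, this]
  simp

/-! ### Inversion of one round of bookkeeping -/

/-- **The four kinds of a good round.** If `stepState` succeeds then either the query has the
wrong length and was answered `[]` (state unchanged), or it names an expanded node and was
answered by the recorded answer (state unchanged), or it names an unexpanded node `m` and was
answered by an EXPANSION answer (state extended by the expansion of `m`), or it names no node and
was answered `[]` (the name is recorded INVALID). [cite: ChildsEtAl2003, §4 (Games 2–4)] -/
theorem stepState_cases {s s' : VState n} {q a : List Bool} (h : s.stepState q a = some s') :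
    (q.length ≠ 2 * n ∧ a = [] ∧ s' = s) ∨
    (q.length = 2 * n ∧ ∃ m, s.nodeOf? (nameOfStr n q) = some m ∧ m ∈ s.par ∧
      a = encL (canon (s.answerSet (s.par.idxOf m) m)) ∧ s' = s) ∨
    (q.length = 2 * n ∧ ∃ m L, s.nodeOf? (nameOfStr n q) = some m ∧ m ∉ s.par ∧ decL n a = some L ∧
      L = canon L.toFinset ∧ (s.freshSet m L).card = 2 ∧
      (m ≠ 0 → s.label (s.parentNode m) ∈ L.toFinset) ∧
      (∀ b ∈ s.freshSet m L, s.nodeOf? b = none ∧ b ∉ s.inv) ∧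
      s' = s.expand m (s.freshSet m L) (nameOfStr n q)) ∨
    (q.length = 2 * n ∧ s.nodeOf? (nameOfStr n q) = none ∧ a = [] ∧ s' = s.addInv (nameOfStr n q)) := by
  unfold stepState at h
  by_cases hq : q.length = 2 * n
  · rw [if_pos hq] at h
    cases hm : s.nodeOf? (nameOfStr n q) with
    | none =>
      rw [hm] at h
      simp only at h
      by_cases ha : a = []
      · rw [if_pos ha] at h
        right; right; right
        exact ⟨hq, rfl, ha, (Option.some.inj h).symm⟩
      · rw [if_neg ha] at h; exact absurd h (by simp)
    | some m =>
      rw [hm] at h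
      simp only at h
      by_cases hp : m ∈ s.par
      · rw [if_pos hp] at h
        by_cases ha : a = encL (canon (s.answerSet (s.par.idxOf m) m))
        · rw [if_pos ha] at h
          right; left
          exact ⟨hq, m, rfl, hp, ha, (Option.some.inj h).symm⟩
        · rw [if_neg ha] at h; exact absurd h (by simp)
      · rw [if_neg hp] at h
        cases hL : decL n a with
        | none => rw [hL] at h; exact absurd h (by simp)
        | some L =>
          rw [hL] at h
          simp only at h
          by_cases hc : L = canon L.toFinset ∧ (s.freshSet m L).card = 2 ∧
              (m ≠ 0 → s.label (s.parentNode m) ∈ L.toFinset) ∧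
              (∀ b ∈ s.freshSet m L, s.nodeOf? b = none ∧ b ∉ s.inv)
          · rw [if_pos hc] at h
            right; right; left
            exact ⟨hq, m, L, rfl, hp, rfl, hc.1, hc.2.1, hc.2.2.1, hc.2.2.2, (Option.some.inj h).symm⟩
          · rw [if_neg hc] at h; exact absurd h (by simp)
  · rw [if_neg hq] at h
    by_cases ha : a = []
    · rw [if_pos ha] at h
      left
      exact ⟨hq, ha, (Option.some.inj h).symm⟩
    · rw [if_neg ha] at h; exact absurd h (by simp)

/-- A wrong-length query answered `[]` leaves the state unchanged. [cite: ChildsEtAl2003, §4 (Game 2)] -/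
theorem stepState_of_length_ne (s : VState n) {q : List Bool} (hq : q.length ≠ 2 * n) :
    s.stepState q [] = some s := by
  unfold stepState; rw [if_neg hq, if_pos rfl]

/-- A repeated query answered by the recorded answer leaves the state unchanged.
[cite: ChildsEtAl2003, §4 (Game 2)] -/
theorem stepState_of_mem_par (s : VState n) {q : List Bool} (hq : q.length = 2 * n) {m : ℕ}
    (hm : s.nodeOf? (nameOfStr n q) = some m) (hp : m ∈ s.par) :
    s.stepState q (encL (canon (s.answerSet (s.par.idxOf m) m))) = some s := by
  unfold stepState; rw [if_pos hq, hm]; simp [hp]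

/-- An unknown string answered `[]` is recorded INVALID. [cite: ChildsEtAl2003, §4 (Game 2)] -/
theorem stepState_of_nodeOf?_eq_none (s : VState n) {q : List Bool} (hq : q.length = 2 * n)
    (hm : s.nodeOf? (nameOfStr n q) = none) :
    s.stepState q [] = some (s.addInv (nameOfStr n q)) := by
  unfold stepState; rw [if_pos hq, hm]; simp

/-- A good expansion answer is accepted. [cite: ChildsEtAl2003, §4 (Game 3)] -/
theorem stepState_expand (hn : 1 ≤ n) (s : VState n) {q : List Bool} (hq : q.length = 2 * n) {m : ℕ}
    (hm : s.nodeOf? (nameOfStr n q) = some m) (hp : m ∉ s.par) (S : Finset (Name n))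
    (hcard : (s.freshSet m (canon S)).card = 2)
    (hpar : m ≠ 0 → s.label (s.parentNode m) ∈ S)
    (hfresh : ∀ b ∈ s.freshSet m (canon S), s.nodeOf? b = none ∧ b ∉ s.inv) :
    s.stepState q (encL (canon S)) = some (s.expand m (s.freshSet m (canon S)) (nameOfStr n q)) := by
  unfold stepState
  rw [if_pos hq, hm]
  simp only
  rw [if_neg hp, decL_encL hn]
  simp only
  rw [if_pos]
  refine ⟨by rw [canon_toFinset], hcard, by rwa [canon_toFinset], hfresh⟩

/-- The fresh set of a canonical listing. [folklore] -/
theorem freshSet_canon (s : VState n) (m : ℕ) (S : Finset (Name n)) :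
    s.freshSet m (canon S) = if m = 0 then S else S.erase (s.label (s.parentNode m)) := by
  simp [freshSet, canon_toFinset]

end VState

/-! ### Stability of the embedding -/

/-- `posStep` does not move nodes other than the two it creates. [cite: ChildsEtAl2003, §4 (Game 5)] -/
theorem posStep_apply_of_ne (σ : CycleDatum n) (par : List ℕ) (c : ℕ → Bool) (j : ℕ) (P : ℕ → Vertex n)
    {m : ℕ} (h1 : m ≠ 2 * j + 1) (h2 : m ≠ 2 * j + 2) : posStep σ par c j P m = P m := by
  simp only [posStep, Function.update_of_ne h2, Function.update_of_ne h1]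

/-- Nodes not yet created sit at the ENTRANCE; in particular so does the root, forever.
[cite: ChildsEtAl2003, §4 (Game 5)] -/
theorem posAux_apply_of_lt (σ : CycleDatum n) (par : List ℕ) (c : ℕ → Bool) (j : ℕ) {m : ℕ}
    (hm : m = 0 ∨ 2 * j < m) : posAux σ par c j m = entrance n := by
  induction j with
  | zero => rfl
  | succ j ih =>
    show posStep σ par c j (posAux σ par c j) m = entrance n
    rw [posStep_apply_of_ne σ par c j _ (by omega) (by omega)]
    exact ih (by omega)

/-- The root is at the ENTRANCE. [cite: ChildsEtAl2003, §4 (Game 5: "Set `π(0)` = ENTRANCE")] -/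
@[simp] theorem posAux_zero_eq (σ : CycleDatum n) (par : List ℕ) (c : ℕ → Bool) (j : ℕ) :
    posAux σ par c j 0 = entrance n :=
  posAux_apply_of_lt σ par c j (Or.inl rfl)

/-- The root is at the ENTRANCE. [cite: ChildsEtAl2003, §4 (Game 5)] -/
@[simp] theorem pos_zero (σ : CycleDatum n) (par : List ℕ) (c : ℕ → Bool) : pos σ par c 0 = entrance n :=
  posAux_zero_eq σ par c _

/-- Later expansions do not move earlier nodes. [cite: ChildsEtAl2003, §4 (Game 5)] -/
theorem posAux_apply_of_le (σ : CycleDatum n) (par : List ℕ) (c : ℕ → Bool) {j j' : ℕ} (hjj : j ≤ j')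
    {m : ℕ} (hm : m ≤ 2 * j) : posAux σ par c j' m = posAux σ par c j m := by
  induction j' with
  | zero =>
    obtain rfl : j = 0 := by omega
    rfl
  | succ j' ih =>
    rcases Nat.lt_or_ge j' j with hlt | hge
    · obtain rfl : j = j' + 1 := by omega
      rfl
    · show posStep σ par c j' (posAux σ par c j') m = _
      rw [posStep_apply_of_ne σ par c j' _ (by omega) (by omega)]
      exact ih hge

/-- **Stability.** Two expansion lists that agree on their first `j` entries and on the parent
lookups those entries need, with coins agreeing below `j`, place the first `2j+1` nodes
identically. [cite: ChildsEtAl2003, §4 (Game 5)] -/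
theorem posAux_stable (σ : CycleDatum n) {par par' : List ℕ} {c c' : ℕ → Bool} (j : ℕ)
    (hpar : ∀ i < j, par.getD i 0 = par'.getD i 0)
    (hval : ∀ i < j, par.getD i 0 ≤ 2 * i)
    (hc : ∀ i < j, c i = c' i) :
    ∀ m, posAux σ par c j m = posAux σ par' c' j m := by
  induction j with
  | zero => intro m; rfl
  | succ j ih =>
    have ih' := ih (fun i hi ↦ hpar i (by omega)) (fun i hi ↦ hval i (by omega)) (fun i hi ↦ hc i (by omega))
    intro m
    show posStep σ par c j (posAux σ par c j) m = posStep σ par' c' j (posAux σ par' c' j) m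
    have hP : posAux σ par c j = posAux σ par' c' j := funext ih'
    simp only [posStep]
    rw [hP, hpar j (by omega), hc j (by omega)]
    have hp : par'.getD j 0 ≤ 2 * j := by rw [← hpar j (by omega)]; exact hval j (by omega)
    rw [hpar ((par'.getD j 0 - 1) / 2) (by omega)]

/-- Appending to the expansion list does not move the existing nodes (valid lists).
[cite: ChildsEtAl2003, §4 (Game 5)] -/
theorem posAux_append (σ : CycleDatum n) (par extra : List ℕ) {c c' : ℕ → Bool}
    (hval : ∀ i (h : i < par.length), par[i] ≤ 2 * i) (hc : ∀ i < par.length, c i = c' i) (m : ℕ) :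
    posAux σ (par ++ extra) c' par.length m = pos σ par c m := by
  unfold pos
  symm
  apply posAux_stable σ par.length
  · intro i hi
    rw [List.getD_eq_getElem?_getD, List.getD_eq_getElem?_getD, List.getElem?_append_left hi]
  · intro i hi
    rw [List.getD_eq_getElem?_getD, List.getElem?_eq_getElem hi]
    exact hval i hi
  · exact hc

/-- The embedding depends only on the coins below the number of expansions.
[cite: ChildsEtAl2003, §4 (Game 5)] -/
theorem pos_congr_coins (σ : CycleDatum n) (par : List ℕ) {c c' : ℕ → Bool}
    (hval : ∀ i (h : i < par.length), par[i] ≤ 2 * i) (hc : ∀ i < par.length, c i = c' i) (m : ℕ) :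
    pos σ par c m = pos σ par c' m := by
  have := posAux_append σ par [] hval hc m
  rw [List.append_nil] at this
  exact this.symm

/-! ### Well-formedness of good views -/

/-- **Good views are well formed**: the expansion list is valid, labels are injective on the
nodes and avoid the INVALID set, and expansions plus INVALID strings number at most the rounds.
[cite: ChildsEtAl2003, §4 (Games 2–4)] -/
theorem viewState_wf (M : OracleAlg β) (x : List Bool) :
    ∀ (as : List (List Bool)) (s : VState n), viewState M x as = some s →
      ValidPar s.par ∧
      (∀ m ≤ 2 * s.E, ∀ m' ≤ 2 * s.E, s.label m = s.label m' → m = m') ∧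
      (∀ m ≤ 2 * s.E, s.label m ∉ s.inv) ∧
      s.E + s.inv.card ≤ as.length ∧
      s.label 0 = fun _ ↦ false := by
  intro as
  induction as using List.reverseRecOn with
  | nil =>
    intro s hs
    rw [viewState_nil] at hs
    cases hs
    refine ⟨⟨List.nodup_nil, fun j h ↦ by simp at h⟩, ?_, by simp, by simp, rfl⟩
    intro m hm m' hm' _
    simp only [VState.E_init, mul_zero, nonpos_iff_eq_zero] at hm hm'
    rw [hm, hm']
  | append_singleton as a ih =>
    intro s' hs'
    obtain ⟨s, q, hs, hq, hst⟩ := viewState_append_singleton_eq_some hs'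
    obtain ⟨⟨hnd, hval⟩, hinj, hdis, hcount, h0⟩ := ih s hs
    rcases VState.stepState_cases hst with ⟨-, -, rfl⟩ | ⟨-, m, -, -, -, rfl⟩ |
        ⟨hql, m, L, hm, hmp, hL, hcanon, hcard, hparent, hfresh, rfl⟩ | ⟨hql, hm, -, rfl⟩
    · exact ⟨⟨hnd, hval⟩, hinj, hdis, by simp; omega, h0⟩
    · exact ⟨⟨hnd, hval⟩, hinj, hdis, by simp; omega, h0⟩
    · -- expansion of node `m`
      obtain ⟨hmE, hml⟩ := VState.nodeOf?_eq_some hm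
      set F := s.freshSet m L with hF
      set d := nameOfStr n q with hd
      obtain ⟨hF0, hF1, hF01, hFeq⟩ := canon_pair_getD hcard d
      have hfreshF : ∀ b ∈ F, ∀ k ≤ 2 * s.E, s.label k ≠ b := fun b hb ↦
        VState.nodeOf?_eq_none.mp (hfresh b hb).1
      refine ⟨⟨?_, ?_⟩, ?_, ?_, ?_, ?_⟩
      · rw [VState.par_expand]
        exact List.nodup_append.mpr ⟨hnd, List.nodup_singleton _,
          fun a ha b hb hab ↦ hmp (by simp at hb; rw [← hb, ← hab]; exact ha)⟩
      · intro j hj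
        simp only [VState.par_expand, List.length_append, List.length_singleton] at hj ⊢
        rcases Nat.lt_or_ge j s.par.length with hlt | hge
        · simp only [List.getElem_append_left hlt]; exact hval j hlt
        · obtain rfl : j = s.par.length := by omega
          rw [List.getElem_append_right (le_refl _)]
          simp only [Nat.sub_self, List.getElem_cons_zero]
          exact hmE
      · -- injectivity of the new labels
        rw [VState.E_expand]
        intro k hk k' hk' hkk
        rcases (by omega : k ≤ 2 * s.E ∨ k = 2 * s.E + 1 ∨ k = 2 * s.E + 2) with hk0 | rfl | rfl <;>
          rcases (by omega : k' ≤ 2 * s.E ∨ k' = 2 * s.E + 1 ∨ k' = 2 * s.E + 2) with hk0' | rfl | rfl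
        · rw [VState.label_expand_of_le _ _ _ _ hk0, VState.label_expand_of_le _ _ _ _ hk0'] at hkk
          exact hinj k hk0 k' hk0' hkk
        · rw [VState.label_expand_of_le _ _ _ _ hk0, VState.label_expand_one] at hkk
          exact absurd hkk (hfreshF _ hF0 k hk0)
        · rw [VState.label_expand_of_le _ _ _ _ hk0, VState.label_expand_two] at hkk
          exact absurd hkk (hfreshF _ hF1 k hk0)
        · rw [VState.label_expand_of_le _ _ _ _ hk0', VState.label_expand_one] at hkk
          exact absurd hkk.symm (hfreshF _ hF0 k' hk0')
        · rfl
        · rw [VState.label_expand_one, VState.label_expand_two] at hkk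
          exact absurd hkk hF01
        · rw [VState.label_expand_of_le _ _ _ _ hk0', VState.label_expand_two] at hkk
          exact absurd hkk.symm (hfreshF _ hF1 k' hk0')
        · rw [VState.label_expand_one, VState.label_expand_two] at hkk
          exact absurd hkk.symm hF01
        · rfl
      · -- labels avoid `inv`
        rw [VState.E_expand, VState.inv_expand]
        intro k hk
        rcases (by omega : k ≤ 2 * s.E ∨ k = 2 * s.E + 1 ∨ k = 2 * s.E + 2) with hk0 | rfl | rfl
        · rw [VState.label_expand_of_le _ _ _ _ hk0]; exact hdis k hk0
        · rw [VState.label_expand_one]; exact (hfresh _ hF0).2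
        · rw [VState.label_expand_two]; exact (hfresh _ hF1).2
      · rw [VState.E_expand, VState.inv_expand, List.length_append, List.length_singleton]; omega
      · rw [VState.label_expand_of_le _ _ _ _ (Nat.zero_le _)]; exact h0
    · -- invalid
      have hnone := VState.nodeOf?_eq_none.mp hm
      refine ⟨⟨hnd, hval⟩, hinj, ?_, ?_, h0⟩
      · intro k hk
        rw [VState.inv_addInv, Finset.mem_insert, not_or]
        exact ⟨hnone k hk, hdis k hk⟩
      · rw [VState.E_addInv, VState.inv_addInv, List.length_append, List.length_singleton]
        have : (insert (nameOfStr n q) s.inv).card ≤ s.inv.card + 1 := Finset.card_insert_le _ _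
        omega

end GluedTrees

end Literature.Computability.QuantumComplexity

/-!
# Glued trees, Theorem 9 (classical lower bound) — IV: a real run realises the random embedding

Theorem-only support file for `ChildsEtAl2003_thm9`. This is the rigorous content of Lemma 7 of
the source ("Using the tree generated by `A'` in Game 5 has the same behavior as using `A` in
Game 4", p. 12): for an actual outcome `(σ, ν)` of Game 1 whose oracle is consistent with a good
view `as` (bookkeeping `s`), the physical vertices behind the known names ARE the random
embedding `pos σ s.par c` of the abstract tree of `s`, for the coins `c = coinsOf σ ν s` read off
the naming — `realizes`:

* (R1) node `m` sits at the vertex named `label m`: `ν (pos … m) = s.label m`;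
* (R2) INVALID strings name no vertex;
* (R3) every non-root node sits at a neighbour of the position of its parent node;
* (R4) expanded non-root nodes sit at non-root vertices (they had three neighbours);
* (R5) the neighbourhood of an expanded node's position is {position it was entered from} ∪
  {positions of its two children}.

Consequences used by the coupling (`GluedTreesThm9Fibre`): the embedding of a realised view is
proper (`proper_of_realizes`), a repeated query is answered by its recorded answer
(`oracle_repeat`), and the answer to the first query of a known unexpanded node is good exactly
when the physical expansion is good (`stepState_oracle_expand`, `not_goodExp_of_stepState_none`).

## References

* [ChildsEtAl2003] A. M. Childs et al., Exponential algorithmic speedup by a quantum walk,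
  STOC 2003, §4 (Games 1–5, Lemma 7).
-/

open Literature.Computability.Complexity

namespace Literature.Computability.QuantumComplexity

namespace GluedTrees

open Finset

variable {n : ℕ} {β : Type}

/-! ### Parent lookups in valid expansion lists -/

namespace VState

/-- In a valid state, the parent node of an existing non-root node is an entry of `par`, hence
an earlier node. [cite: ChildsEtAl2003, §4 (Game 5)] -/
theorem parentNode_eq_getElem {s : VState n} (hval : ∀ j (h : j < s.par.length), s.par[j] ≤ 2 * j)
    {p : ℕ} (hp1 : 1 ≤ p) (hp : p ≤ 2 * s.E) :
    ∃ h : (p - 1) / 2 < s.par.length, s.parentNode p = s.par[(p - 1) / 2] ∧ s.parentNode p ≤ p - 1 := by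
  have hlt : (p - 1) / 2 < s.par.length := by unfold E at hp; omega
  refine ⟨hlt, ?_, ?_⟩
  · unfold parentNode; rw [List.getD_eq_getElem?_getD, List.getElem?_eq_getElem hlt]; rfl
  · unfold parentNode; rw [List.getD_eq_getElem?_getD, List.getElem?_eq_getElem hlt]
    have := hval _ hlt
    simp only [Option.getD_some]
    omega

/-- In a valid state, the parent node of an existing node is an existing node. [folklore] -/
theorem parentNode_le {s : VState n} (hval : ∀ j (h : j < s.par.length), s.par[j] ≤ 2 * j)
    {p : ℕ} (hp : p ≤ 2 * s.E) : s.parentNode p ≤ 2 * s.E := by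
  rcases Nat.eq_zero_or_pos p with rfl | hp1
  · unfold parentNode
    rw [List.getD_eq_getElem?_getD]
    cases h : s.par[(0 - 1) / 2]? with
    | none => simp
    | some v =>
      simp only [Option.getD_some]
      have := List.getElem?_eq_some_iff.mp h
      obtain ⟨hlt, rfl⟩ := this
      have := hval _ hlt
      omega
  · obtain ⟨-, -, h⟩ := parentNode_eq_getElem hval hp1 hp
    omega

end VState

/-! ### The coins and the embedding across one round -/

/-- Recording an INVALID string does not change the coins. [folklore] -/
theorem coinsOf_addInv (σ : CycleDatum n) (ν : Vertex n ↪ Name n) (s : VState n) (a : Name n) :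
    coinsOf σ ν (s.addInv a) = coinsOf σ ν s := rfl

/-- An expansion does not change the earlier coins (valid state). [cite: ChildsEtAl2003, §4 (Game 5)] -/
theorem coinsOf_expand_of_lt (σ : CycleDatum n) (ν : Vertex n ↪ Name n) (s : VState n)
    (hval : ∀ j (h : j < s.par.length), s.par[j] ≤ 2 * j) (m : ℕ) (F : Finset (Name n)) (d : Name n)
    {j : ℕ} (hj : j < s.E) : coinsOf σ ν (s.expand m F d) j = coinsOf σ ν s j := by
  have hE : s.par.length = s.E := rfl
  have hpj : (s.expand m F d).par[j]?.getD 0 = s.par[j]'(by omega) := by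
    rw [VState.par_expand, List.getElem?_append_left (by omega), List.getElem?_eq_getElem (by omega)]
    rfl
  have hp : s.par[j]?.getD 0 = s.par[j]'(by omega) := by
    rw [List.getElem?_eq_getElem (by omega)]; rfl
  have hple : s.par[j]'(by omega) ≤ 2 * j := hval j (by omega)
  unfold coinsOf
  simp only [List.getD_eq_getElem?_getD, hpj, hp]
  rw [VState.label_expand_of_le _ _ _ _ (by omega : 2 * j + 1 ≤ 2 * s.E),
    VState.label_expand_of_le _ _ _ _ (show s.par[j]'(by omega) ≤ 2 * s.E by omega)]
  rcases Nat.eq_zero_or_pos (s.par[j]'(by omega)) with h0 | hpos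
  · simp [h0]
  · have hne : s.par[j]'(by omega) ≠ 0 := by omega
    simp only [hne, if_false]
    rw [VState.parentNode_expand _ _ _ _ hpos (by omega),
      VState.label_expand_of_le _ _ _ _ (VState.parentNode_le hval (by omega))]

/-- **The embedding after one more expansion** (valid list, coins agreeing below `E`): the old
nodes stay, and the two new nodes go to the onward options of the expanded node's position, in
the order given by the new coin. [cite: ChildsEtAl2003, §4 (Game 5)] -/
theorem pos_append_singleton (σ : CycleDatum n) (par : List ℕ) (p : ℕ) {c c' : ℕ → Bool}
    (hval : ∀ i (h : i < par.length), par[i] ≤ 2 * i) (hc : ∀ i < par.length, c i = c' i)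
    (hp : p ≤ 2 * par.length) :
    pos σ (par ++ [p]) c' =
      Function.update (Function.update (pos σ par c) (2 * par.length + 1)
        ((stepOpts σ (pos σ par c p)
          (if p = 0 then none else some (pos σ par c (par.getD ((p - 1) / 2) 0)))).getD
          (if c' par.length then 1 else 0) (entrance n)))
        (2 * par.length + 2)
        ((stepOpts σ (pos σ par c p)
          (if p = 0 then none else some (pos σ par c (par.getD ((p - 1) / 2) 0)))).getD
          (if c' par.length then 0 else 1) (entrance n)) := by
  have hE : (par ++ [p]).length = par.length + 1 := by simp
  have h1 : pos σ (par ++ [p]) c' = posStep σ (par ++ [p]) c' par.length (posAux σ (par ++ [p]) c' par.length) := by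
    unfold pos; rw [hE]; rfl
  have h2 : posAux σ (par ++ [p]) c' par.length = pos σ par c := funext (posAux_append σ par [p] hval hc)
  rw [h1, h2]
  unfold posStep
  have h3 : (par ++ [p]).getD par.length 0 = p := by
    rw [List.getD_eq_getElem?_getD]; simp
  simp only [h3]
  by_cases h0 : p = 0
  · simp [h0]
  · have h4 : (par ++ [p]).getD ((p - 1) / 2) 0 = par.getD ((p - 1) / 2) 0 := by
      rw [List.getD_eq_getElem?_getD, List.getD_eq_getElem?_getD, List.getElem?_append_left (by omega)]
    simp only [h4]

/-! ### The simulation theorem -/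

section Realizes

variable (hn : 1 ≤ n) (σ : CycleDatum n) (ν : Vertex n ↪ Name n) (hν : ν (entrance n) = fun _ ↦ false)
  (M : OracleAlg β) (x : List Bool)

include hn hν in
/-- **A consistent real outcome realises the random embedding of its view** (Lemma 7, made
precise): see the module docstring for (R1)–(R5). [cite: ChildsEtAl2003, §4 (Lemma 7)] -/
theorem realizes :
    ∀ (as : List (List Bool)) (s : VState n), viewState M x as = some s →
      Cons M x (strOracle σ ν) as →
      (∀ m ≤ 2 * s.E, ν (pos σ s.par (coinsOf σ ν s) m) = s.label m) ∧
      (∀ a ∈ s.inv, ∀ v, ν v ≠ a) ∧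
      (∀ m, 1 ≤ m → m ≤ 2 * s.E →
        pos σ s.par (coinsOf σ ν s) m ∈ (graph n σ).neighborFinset (pos σ s.par (coinsOf σ ν s) (s.parentNode m))) ∧
      (∀ j (hj : j < s.par.length), s.par[j] ≠ 0 → depth (pos σ s.par (coinsOf σ ν s) s.par[j]) ≠ 0) ∧
      (∀ j (hj : j < s.par.length), (graph n σ).neighborFinset (pos σ s.par (coinsOf σ ν s) s.par[j]) =
        (if s.par[j] = 0 then ∅ else {pos σ s.par (coinsOf σ ν s) (s.parentNode s.par[j])}) ∪
          {pos σ s.par (coinsOf σ ν s) (2 * j + 1), pos σ s.par (coinsOf σ ν s) (2 * j + 2)}) := by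
  intro as
  induction as using List.reverseRecOn with
  | nil =>
    intro s hs _
    rw [viewState_nil] at hs
    cases hs
    refine ⟨?_, by simp, ?_, ?_, ?_⟩
    · intro m hm
      simp only [VState.E_init, mul_zero, nonpos_iff_eq_zero] at hm
      subst hm
      rw [VState.par_init, pos_zero, hν, VState.label_init]
    · intro m h1 h2; simp at h2; omega
    · intro j hj; simp at hj
    · intro j hj; simp at hj
  | append_singleton as a ih =>
    intro s' hs' hcons'
    obtain ⟨s, q, hs, hq, hst⟩ := viewState_append_singleton_eq_some hs'
    rw [cons_append_singleton_iff] at hcons'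
    obtain ⟨hcons, q', hq', hOq⟩ := hcons'
    rw [hq] at hq'
    cases hq'
    obtain ⟨R1, R2, R3, R4, R5⟩ := ih s hs hcons
    obtain ⟨⟨hnd, hval⟩, hinj, hdis, -, h0⟩ := viewState_wf M x as s hs
    rcases VState.stepState_cases hst with ⟨-, -, rfl⟩ | ⟨-, m, -, -, -, rfl⟩ |
        ⟨hql, p, L, hm, hmp, hL, hcanon, hcard, hparent, hfresh, rfl⟩ | ⟨hql, hm, ha, rfl⟩
    · exact ⟨R1, R2, R3, R4, R5⟩
    · exact ⟨R1, R2, R3, R4, R5⟩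
    · -- EXPANSION of node `p`
      obtain ⟨hpE, hpl⟩ := VState.nodeOf?_eq_some hm
      -- notation
      set c := coinsOf σ ν s with hc
      set P := pos σ s.par c with hP
      set qa := nameOfStr n q with hqa
      set F := s.freshSet p L with hF
      set s' := s.expand p F qa with hs'def
      set c' := coinsOf σ ν s' with hc'
      set P' := pos σ s'.par c' with hP'
      -- the query is the name of the vertex `P p`
      have hq_eq : q = List.ofFn (ν (P p)) := by rw [R1 p hpE, hpl, hqa, ofFn_nameOfStr hql]
      -- the real answer
      have ha : a = encL (canon (((graph n σ).neighborFinset (P p)).map ν)) := by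
        rw [← hOq, hq_eq, strOracle_apply_name]
      have hLeq : L = canon (((graph n σ).neighborFinset (P p)).map ν) := by
        have := decL_encL hn (canon (((graph n σ).neighborFinset (P p)).map ν))
        rw [← ha, hL] at this
        exact Option.some.inj this
      have hLset : L.toFinset = ((graph n σ).neighborFinset (P p)).map ν := by
        rw [hLeq, canon_toFinset]
      -- the entering vertex and the options
      set u : Option (Vertex n) := if p = 0 then none else some (P (s.parentNode p)) with hu
      set os := stepOpts σ (P p) u with hos
      have hpar_le : s.parentNode p ≤ 2 * s.E := VState.parentNode_le hval hpE
      have hos_spec : os.toFinset = (if p = 0 then (graph n σ).neighborFinset (P p)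
          else ((graph n σ).neighborFinset (P p)).erase (P (s.parentNode p))) ∧ os.Nodup := by
        by_cases hp0 : p = 0
        · have hPp : P p = entrance n := by rw [hp0, hP, pos_zero]
          have hu0 : u = none := by simp [hu, hp0]
          rw [hos, hu0, if_pos hp0, hPp]
          exact ⟨(stepOpts_entrance_none hn σ).1, (stepOpts_entrance_none hn σ).2.1⟩
        · simp only [hos, hu, hp0, if_false]
          have hadj : P (s.parentNode p) ∈ (graph n σ).neighborFinset (P p) := by
            rw [SimpleGraph.mem_neighborFinset, SimpleGraph.adj_comm, ← SimpleGraph.mem_neighborFinset]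
            exact R3 p (by omega) hpE
          exact stepOpts_toFinset hn σ hadj
      have hFeq : F = os.toFinset.map ν := by
        rw [hos_spec.1, hF, VState.freshSet, hLset]
        by_cases hp0 : p = 0
        · simp [hp0]
        · simp only [hp0, if_false]
          rw [Finset.map_erase, R1 _ hpar_le]
      have hlen : os.length = 2 := by
        rw [← List.toFinset_card_of_nodup hos_spec.2, ← Finset.card_map ν, ← hFeq]; exact hcard
      obtain ⟨o₀, o₁, hos01⟩ := List.length_eq_two.mp hlen
      have hne01 : o₀ ≠ o₁ := by
        have := hos_spec.2; rw [hos01] at this; simpa using this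
      have hFpair : F = {ν o₀, ν o₁} := by rw [hFeq, hos01]; simp
      -- the new labels
      obtain ⟨hF0, hF1, hF01, hFeq'⟩ := canon_pair_getD hcard qa
      have hlab1 : s'.label (2 * s.E + 1) = (canon F).getD 0 qa := VState.label_expand_one _ _ _ _
      have hlab2 : s'.label (2 * s.E + 2) = (canon F).getD 1 qa := VState.label_expand_two _ _ _ _
      -- coins agree below `E`
      have hcc : ∀ i < s.par.length, c i = c' i := fun i hi ↦
        (coinsOf_expand_of_lt σ ν s hval p F qa hi).symm
      -- the new coin
      have hcE : c' s.par.length = decide (vtx ν ((canon F).getD 0 qa) = o₁) := by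
        show coinsOf σ ν s' s.par.length = _
        unfold coinsOf
        have hpE' : s'.par.getD s.par.length 0 = p := by
          rw [VState.par_expand, List.getD_eq_getElem?_getD]; simp
        simp only [hpE']
        rw [show 2 * s.par.length + 1 = 2 * s.E + 1 from rfl, hlab1,
          VState.label_expand_of_le _ _ _ _ hpE, ← R1 p hpE, vtx_apply]
        have hu' : (if p = 0 then none else some (vtx ν (s'.label (s'.parentNode p)))) = u := by
          by_cases hp0 : p = 0
          · simp [hu, hp0]
          · simp only [hu, hp0, if_false]
            rw [VState.parentNode_expand _ _ _ _ (by omega) hpE,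
              VState.label_expand_of_le _ _ _ _ hpar_le, ← R1 _ hpar_le, vtx_apply]
        rw [hu', ← hos, hos01]
        rfl
      -- the new positions
      have hP'eq := pos_append_singleton σ s.par p hval hcc hpE
      have hparE : s.par.getD ((p - 1) / 2) 0 = s.parentNode p := rfl
      rw [hparE] at hP'eq
      have hP'old : ∀ k ≤ 2 * s.E, P' k = P k := by
        intro k hk
        rw [hP', VState.par_expand, hP'eq, Function.update_of_ne (by unfold VState.E at hk; omega),
          Function.update_of_ne (by unfold VState.E at hk; omega)]
      have hP'1 : P' (2 * s.E + 1) = os.getD (if c' s.par.length then 1 else 0) (entrance n) := by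
        rw [hP', VState.par_expand, hP'eq, Function.update_of_ne (by unfold VState.E; omega)]
        show Function.update P (2 * s.par.length + 1) _ (2 * s.par.length + 1) = _
        rw [Function.update_self]
      have hP'2 : P' (2 * s.E + 2) = os.getD (if c' s.par.length then 0 else 1) (entrance n) := by
        rw [hP', VState.par_expand, hP'eq]
        show Function.update _ (2 * s.par.length + 2) _ (2 * s.par.length + 2) = _
        rw [Function.update_self]
      -- the two cases for the coin
      have hnew : ν (P' (2 * s.E + 1)) = s'.label (2 * s.E + 1) ∧ ν (P' (2 * s.E + 2)) = s'.label (2 * s.E + 2) ∧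
          ({P' (2 * s.E + 1), P' (2 * s.E + 2)} : Finset (Vertex n)) = {o₀, o₁} := by
        rw [hlab1, hlab2, hP'1, hP'2, hcE, hos01]
        have hmem0 : (canon F).getD 0 qa ∈ ({ν o₀, ν o₁} : Finset (Name n)) := hFpair ▸ hF0
        have hmem1 : (canon F).getD 1 qa ∈ ({ν o₀, ν o₁} : Finset (Name n)) := hFpair ▸ hF1
        simp only [Finset.mem_insert, Finset.mem_singleton] at hmem0 hmem1
        rcases hmem0 with h00 | h01
        · have h11 : (canon F).getD 1 qa = ν o₁ := by
            rcases hmem1 with h10 | h11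
            · exact absurd (h00.trans h10.symm) hF01
            · exact h11
          rw [h00, h11, vtx_apply]
          simp [hne01]
        · have h10 : (canon F).getD 1 qa = ν o₀ := by
            rcases hmem1 with h10 | h11
            · exact h10
            · exact absurd (h01.trans h11.symm) hF01
          rw [h01, h10, vtx_apply]
          simp [Finset.pair_comm]
      obtain ⟨hnew1, hnew2, hnewpair⟩ := hnew
      have hE' : s'.E = s.E + 1 := VState.E_expand _ _ _ _
      have hpar' : s'.par = s.par ++ [p] := rfl
      -- positions of the new nodes are options, hence neighbours of `P p`
      have hopt_nbr : ∀ w ∈ ({o₀, o₁} : Finset (Vertex n)), w ∈ (graph n σ).neighborFinset (P p) := by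
        intro w hw
        have : w ∈ os.toFinset := by rw [hos01]; simpa using hw
        rw [hos_spec.1] at this
        split_ifs at this with hp0
        · exact this
        · exact Finset.mem_of_mem_erase this
      refine ⟨?_, ?_, ?_, ?_, ?_⟩
      · -- R1
        intro k hk
        rw [hE'] at hk
        rcases (by omega : k ≤ 2 * s.E ∨ k = 2 * s.E + 1 ∨ k = 2 * s.E + 2) with hk0 | rfl | rfl
        · rw [hP'old k hk0, VState.label_expand_of_le _ _ _ _ hk0]; exact R1 k hk0
        · exact hnew1
        · exact hnew2
      · -- R2
        rw [VState.inv_expand]; exact R2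
      · -- R3
        intro k hk1 hk
        rw [hE'] at hk
        rcases (by omega : k ≤ 2 * s.E ∨ k = 2 * s.E + 1 ∨ k = 2 * s.E + 2) with hk0 | rfl | rfl
        · rw [hP'old k hk0, VState.parentNode_expand _ _ _ _ hk1 hk0,
            hP'old _ (VState.parentNode_le hval hk0)]
          exact R3 k hk1 hk0
        · rw [VState.parentNode_expand_new _ _ _ _ (Or.inl rfl), hP'old p hpE]
          apply hopt_nbr; rw [← hnewpair]; simp
        · rw [VState.parentNode_expand_new _ _ _ _ (Or.inr rfl), hP'old p hpE]
          apply hopt_nbr; rw [← hnewpair]; simp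
      · -- R4
        intro j hj hj0
        have hj' : j < (s.par ++ [p]).length := by rw [← hpar']; exact hj
        have hv : s'.par[j]'hj = (s.par ++ [p])[j]'hj' := rfl
        rw [hv] at hj0 ⊢
        rw [List.length_append, List.length_singleton] at hj'
        rcases Nat.lt_or_ge j s.par.length with hlt | hge
        · rw [List.getElem_append_left hlt] at hj0 ⊢
          rw [hP'old _ ((hval j hlt).trans (by unfold VState.E; omega))]
          exact R4 j hlt hj0
        · obtain rfl : j = s.par.length := by omega
          rw [List.getElem_concat_length rfl] at hj0 ⊢
          rw [hP'old p hpE]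
          intro hd0
          have hadj : P (s.parentNode p) ∈ (graph n σ).neighborFinset (P p) := by
            rw [SimpleGraph.mem_neighborFinset, SimpleGraph.adj_comm, ← SimpleGraph.mem_neighborFinset]
            exact R3 p (by omega) hpE
          have := length_stepOpts hn σ hadj
          rw [if_pos hd0] at this
          have hos' : os = stepOpts σ (P p) (some (P (s.parentNode p))) := by
            simp [hos, hu, hj0]
          rw [← hos', hlen] at this
          exact absurd this (by norm_num)
      · -- R5
        intro j hj
        have hj' : j < (s.par ++ [p]).length := by rw [← hpar']; exact hj
        have hv : s'.par[j]'hj = (s.par ++ [p])[j]'hj' := rfl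
        rw [hv]
        rw [List.length_append, List.length_singleton] at hj'
        rcases Nat.lt_or_ge j s.par.length with hlt | hge
        · rw [List.getElem_append_left hlt]
          have hpj : s.par[j] ≤ 2 * s.E := (hval j hlt).trans (by unfold VState.E; omega)
          rw [hP'old s.par[j] hpj, hP'old (2 * j + 1) (by unfold VState.E; omega),
            hP'old (2 * j + 2) (by unfold VState.E; omega)]
          rcases Nat.eq_zero_or_pos s.par[j] with hz | hpos
          · rw [if_pos hz]
            have := R5 j hlt
            rw [if_pos hz] at this
            exact this
          · rw [if_neg (by omega), VState.parentNode_expand _ _ _ _ hpos hpj,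
              hP'old (s.parentNode s.par[j]) (VState.parentNode_le hval hpj)]
            have := R5 j hlt
            rw [if_neg (by omega)] at this
            exact this
        · obtain rfl : j = s.par.length := by omega
          rw [List.getElem_concat_length rfl]
          rw [hP'old p hpE, show 2 * s.par.length + 1 = 2 * s.E + 1 from rfl,
            show 2 * s.par.length + 2 = 2 * s.E + 2 from rfl, hnewpair]
          have hset : ((graph n σ).neighborFinset (P p)) =
              (if p = 0 then ∅ else {P (s.parentNode p)}) ∪ os.toFinset := by
            rw [hos_spec.1]
            by_cases hp0 : p = 0
            · simp [hp0]
            · simp only [hp0, if_false]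
              have hadj : P (s.parentNode p) ∈ (graph n σ).neighborFinset (P p) := by
                rw [SimpleGraph.mem_neighborFinset, SimpleGraph.adj_comm, ← SimpleGraph.mem_neighborFinset]
                exact R3 p (by omega) hpE
              rw [← Finset.insert_eq, Finset.insert_erase hadj]
          rw [hset, hos01]
          by_cases hp0 : p = 0
          · simp [hp0]
          · simp only [hp0, if_false]
            rw [VState.parentNode_expand _ _ _ _ (by omega) hpE, hP'old _ hpar_le]
            simp
    · -- INVALID
      refine ⟨R1, ?_, R3, R4, R5⟩
      intro b hb v hv
      rw [VState.inv_addInv, Finset.mem_insert] at hb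
      rcases hb with rfl | hb
      · -- the new INVALID string names no vertex
        have hq_eq : q = List.ofFn (ν v) := by rw [hv, ofFn_nameOfStr hql]
        have := strOracle_apply_name_ne_nil hn σ ν v
        rw [← hq_eq, hOq] at this
        exact this ha
      · exact R2 b hb v hv

end Realizes

end GluedTrees

end Literature.Computability.QuantumComplexity
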